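import Summits.CriticalPhenomena.PercolationContinuityZ3.Theorems.PercNearOneGluingNoHeavyLowerTailGroupThreePointLBClusters
import Mathlib.Tactic.FinCases
import HarnessLib

/-!
# `NoHeavyLowerTail` (stmt-CriticalPhenomena-4575) — GROUP three-point lower bound `GRP3PTLB`, II:
# the four switchings `Ψ₁, Ψ₂, Ψ₃, Ψ₄′` for vertex sets preserve `μ ⊗ μ ⊗ μ`

Support file (prover prim-ineq-prove-3, gen 5; `--supports stmt-CriticalPhenomena-4575`).  No named facts, no sorries.

The four three-copy switchings of prim-lit-2's "Variant C" certificate (PROOF-3PTLB.md, §Variant C) with the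
explored points replaced by vertex SETS (this seat's FINDING-GRP3PTLB.md): on triples `x = (X, Y, Z)` of
configurations, with `𝒜 = clS X A`, `ℬ = clS X B`, `𝒞 = clS X C` and `splice F K₁ K₂ =` (`K₁` on `F`, `K₂` off `F`),
* `Ψ₁(X,Y,Z) = (Y_{touch 𝒜} X, X_{touch 𝒜} Y, Z)` — explore the cluster of the set `A` in copy `0`, exchange `0 ↔ 1` there;
* `Ψ₂(X,Y,Z) = (Z_{touch ℬ} X, Y, X_{touch ℬ} Z)`;
* `Ψ₃(X,Y,Z) = (Y_{touch 𝒜} Z_{touch ℬ ∖ touch 𝒜} X, X_{touch 𝒜} Y, X_{touch ℬ ∖ touch 𝒜} Z)`;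
* `Ψ₄′(X,Y,Z) = (Z_{touch 𝒞} Y_{touch 𝒜 ∖ touch 𝒞} X, X_{touch 𝒜 ∖ touch 𝒞} Y, X_{touch 𝒞} Z)` (explore `𝒞 = clS X C` first, to
  copy `2`, then the cluster of `A` on the unused pairs, to copy `1`; the certificate uses `C = {c}`).
All are instances of `DecisionTree.splice3` [GladkovZimin2024, Lemma 4.2 / proof of Thm 4.6, three-copy form],
`Ψ₄′` after exchanging copies `1, 2` (exactly as `ThreePointLB.phi4`); the regions are self-determined by
`GroupThreePointLB.selfDetermined_touch_clS`.  Hence `sum_wt3W_psi1 … sum_wt3W_psi4`.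
-/

noncomputable section

namespace Summit.CriticalPhenomena.PercolationContinuityZ3.Theorems

namespace GroupThreePointLB

open Finset Literature.Probability.Percolation Literature.Probability.Percolation.DecisionTree
open Literature.Probability.Percolation.Gladkov ThreePointLB
open scoped Classical

variable {V : Type*} [Fintype V] [DecidableEq V]

/-! ### The four switchings -/

/-- `Ψ₁(X,Y,Z) = (Y on touch 𝒜 | X, X on touch 𝒜 | Y, Z)`, `𝒜 = clS X A`. [this work] -/
def psi1 (A : Finset V) : (Fin 3 → Finset (Sym2 V)) → (Fin 3 → Finset (Sym2 V)) :=
  splice3 (fun K => touch (clS K A)) (fun _ => ∅)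

/-- `Ψ₂(X,Y,Z) = (Z on touch ℬ | X, Y, X on touch ℬ | Z)`, `ℬ = clS X B`. [this work] -/
def psi2 (B : Finset V) : (Fin 3 → Finset (Sym2 V)) → (Fin 3 → Finset (Sym2 V)) :=
  splice3 (fun _ => ∅) (fun K => touch (clS K B))

/-- `Ψ₃(X,Y,Z)`: `Ψ₁`'s exploration, then explore the cluster of `B` in copy `0` on the unused pairs and exchange
copies `0` and `2` there. [this work] -/
def psi3 (A B : Finset V) : (Fin 3 → Finset (Sym2 V)) → (Fin 3 → Finset (Sym2 V)) :=
  splice3 (fun K => touch (clS K A)) (fun K => touch (clS K B) \ touch (clS K A))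

/-- `Ψ₄′(X,Y,Z)`: explore the cluster of the set `C` (in the certificate, `C = {c}`) in copy `0` and exchange copies
`0, 2` there, then the cluster of `A` on the unused pairs and exchange copies `0, 1` there (the two-region switching
conjugated by the exchange of copies `1` and `2`, as `ThreePointLB.phi4`). [this work] -/
def psi4 (C A : Finset V) (x : Fin 3 → Finset (Sym2 V)) : Fin 3 → Finset (Sym2 V) := fun k =>
  splice3 (fun K => touch (clS K C)) (fun K => touch (clS K A) \ touch (clS K C))
    (fun i => x (Equiv.swap 1 2 i)) (Equiv.swap 1 2 k)

section Outputs

variable (A B C : Finset V) (x : Fin 3 → Finset (Sym2 V))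

/-- Output `0` of `Ψ₁`. [this work] -/
@[simp] theorem psi1_zero : psi1 A x 0 = splice (touch (clS (x 0) A)) (x 1) (x 0) := by
  rw [psi1, splice3_zero, splice_empty]
/-- Output `1` of `Ψ₁`. [this work] -/
@[simp] theorem psi1_one : psi1 A x 1 = splice (touch (clS (x 0) A)) (x 0) (x 1) := by
  rw [psi1, splice3_one]
/-- Output `2` of `Ψ₁`. [this work] -/
@[simp] theorem psi1_two : psi1 A x 2 = x 2 := by
  rw [psi1, splice3_two, splice_empty]
/-- Output `0` of `Ψ₂`. [this work] -/
@[simp] theorem psi2_zero : psi2 B x 0 = splice (touch (clS (x 0) B)) (x 2) (x 0) := by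
  rw [psi2, splice3_zero, splice_empty]
/-- Output `1` of `Ψ₂`. [this work] -/
@[simp] theorem psi2_one : psi2 B x 1 = x 1 := by
  rw [psi2, splice3_one, splice_empty]
/-- Output `2` of `Ψ₂`. [this work] -/
@[simp] theorem psi2_two : psi2 B x 2 = splice (touch (clS (x 0) B)) (x 0) (x 2) := by
  rw [psi2, splice3_two]
/-- Output `0` of `Ψ₃`. [this work] -/
@[simp] theorem psi3_zero : psi3 A B x 0 =
    splice (touch (clS (x 0) A)) (x 1) (splice (touch (clS (x 0) B) \ touch (clS (x 0) A)) (x 2) (x 0)) := by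
  rw [psi3, splice3_zero]
/-- Output `1` of `Ψ₃`. [this work] -/
@[simp] theorem psi3_one : psi3 A B x 1 = splice (touch (clS (x 0) A)) (x 0) (x 1) := by
  rw [psi3, splice3_one]
/-- Output `2` of `Ψ₃`. [this work] -/
@[simp] theorem psi3_two : psi3 A B x 2 = splice (touch (clS (x 0) B) \ touch (clS (x 0) A)) (x 0) (x 2) := by
  rw [psi3, splice3_two]

/-- `(1 2)` fixes `0` in `Fin 3`. [folklore] -/
private theorem swap12_0 : (Equiv.swap (1 : Fin 3) 2) 0 = 0 := by decide
/-- `(1 2)` sends `1 ↦ 2` in `Fin 3`. [folklore] -/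
private theorem swap12_1 : (Equiv.swap (1 : Fin 3) 2) 1 = 2 := by decide
/-- `(1 2)` sends `2 ↦ 1` in `Fin 3`. [folklore] -/
private theorem swap12_2 : (Equiv.swap (1 : Fin 3) 2) 2 = 1 := by decide

/-- Output `0` of `Ψ₄′`. [this work] -/
@[simp] theorem psi4_zero : psi4 C A x 0 =
    splice (touch (clS (x 0) C)) (x 2) (splice (touch (clS (x 0) A) \ touch (clS (x 0) C)) (x 1) (x 0)) := by
  simp only [psi4, swap12_0, splice3_zero, swap12_1, swap12_2]
/-- Output `1` of `Ψ₄′`. [this work] -/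
@[simp] theorem psi4_one : psi4 C A x 1 = splice (touch (clS (x 0) A) \ touch (clS (x 0) C)) (x 0) (x 1) := by
  simp only [psi4, swap12_1, splice3_two, swap12_0, swap12_2]
/-- Output `2` of `Ψ₄′`. [this work] -/
@[simp] theorem psi4_two : psi4 C A x 2 = splice (touch (clS (x 0) C)) (x 0) (x 2) := by
  simp only [psi4, swap12_2, splice3_one, swap12_0, swap12_1]

end Outputs

/-! ### Each switching preserves the triple law -/

section Law

variable (p : Sym2 V → ℝ) (D : Finset (Sym2 V)) (A B C : Finset V) (f : (Fin 3 → Finset (Sym2 V)) → ℝ)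

/-- **`Ψ₁` preserves `μ ⊗ μ ⊗ μ`.** [cite: GladkovZimin2024, Lemma 4.2 and Example 4.4 (set-rooted exploration)] -/
theorem sum_wt3W_psi1 :
    ∑ x ∈ triples D, wt3W D p x * f (psi1 A x) = ∑ x ∈ triples D, wt3W D p x * f x := by
  unfold psi1
  exact sum_wt3W_comp_splice3 p (selfDetermined_touch_clS A) (fun K => Finset.disjoint_empty_left _)
    (fun _ _ _ => rfl) D f

/-- **`Ψ₂` preserves `μ ⊗ μ ⊗ μ`.** [cite: GladkovZimin2024, Lemma 4.2 and Example 4.4 (set-rooted exploration)] -/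
theorem sum_wt3W_psi2 :
    ∑ x ∈ triples D, wt3W D p x * f (psi2 B x) = ∑ x ∈ triples D, wt3W D p x * f x := by
  unfold psi2
  refine sum_wt3W_comp_splice3 p (fun _ _ _ => rfl) (fun K => Finset.disjoint_empty_right _)
    (fun K K' h => ?_) D f
  rw [clS_eq_of_agree fun e he => h e (Finset.mem_union_right _ he)]

/-- **`Ψ₃` preserves `μ ⊗ μ ⊗ μ`.** [cite: GladkovZimin2024, Lemma 4.2 and proof of Thm. 4.6] -/
theorem sum_wt3W_psi3 :
    ∑ x ∈ triples D, wt3W D p x * f (psi3 A B x) = ∑ x ∈ triples D, wt3W D p x * f x := by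
  unfold psi3
  exact sum_wt3W_comp_splice3 p (selfDetermined_touch_clS A) (fun K => Finset.sdiff_disjoint)
    (touch_clS_sdiff_congr A B) D f

/-- **`Ψ₄′` preserves `μ ⊗ μ ⊗ μ`** (two-region switching conjugated by the exchange of copies `1, 2`).
[cite: GladkovZimin2024, Lemma 4.2 and proof of Thm. 4.6] -/
theorem sum_wt3W_psi4 :
    ∑ x ∈ triples D, wt3W D p x * f (psi4 C A x) = ∑ x ∈ triples D, wt3W D p x * f x := by
  set σ : Equiv.Perm (Fin 3) := Equiv.swap 1 2 with hσ
  set R : Finset (Sym2 V) → Finset (Sym2 V) := fun K => touch (clS K C) with hR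
  set S : Finset (Sym2 V) → Finset (Sym2 V) := fun K => touch (clS K A) \ touch (clS K C) with hS
  have hphi : ∀ x, psi4 C A x = fun k => splice3 R S (fun i => x (σ i)) (σ k) := fun x => rfl
  calc ∑ x ∈ triples D, wt3W D p x * f (psi4 C A x)
      = ∑ x ∈ triples D, (fun y => wt3W D p y * f (fun k => splice3 R S y (σ k))) (fun i => x (σ i)) := by
        refine Finset.sum_congr rfl fun x _ => ?_
        simp only [hphi, DTree3.wt3W_comp_perm]
    _ = ∑ y ∈ triples D, wt3W D p y * f (fun k => splice3 R S y (σ k)) :=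
        DTree3.sum_triples_comp_perm D σ (fun y => wt3W D p y * f (fun k => splice3 R S y (σ k)))
    _ = ∑ y ∈ triples D, wt3W D p y * f (fun k => y (σ k)) :=
        sum_wt3W_comp_splice3 p (selfDetermined_touch_clS C) (fun K => Finset.sdiff_disjoint)
          (touch_clS_sdiff_congr C A) D (fun y => f (fun k => y (σ k)))
    _ = ∑ y ∈ triples D, wt3W D p y * f y := by
        have h := DTree3.sum_triples_comp_perm D σ (fun y => wt3W D p y * f y)
        simpa only [DTree3.wt3W_comp_perm] using h

end Law

end GroupThreePointLB

end Summit.CriticalPhenomena.PercolationContinuityZ3.Theorems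

end
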